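import Mathlib
import Literature.Analysis.FluidPDE.TaoCascadeODEProofs
import Literature.Analysis.FluidPDE.Tao2016AveragedNS.LocalCascadeSolutions
import HarnessLib

/-!
# `HeteroclinicTriggerChain` — crux `TriggerChainTable` (item stmt-NavierStokesRegularity-22786):
  the STATIC TABLE ALGEBRA of the three-constant trigger-chain design (registered stub `stub_static`)

The explicit four-mode table on Tao's topology `S = {(0,0,0),(1,0,0),(0,1,0),(0,0,1)}` (modes
`i₀ = 0` carrier `x`, `i₁ = 1` trigger `u`, `2, 3` idle; rates `e = g = 1`; unlisted entries `0`):

* trigger (same shell, `μ = (0,0,0)`): `α₀(0,1,1) = α₀(1,0,1) = 1/2`, `α₀(1,1,0) = -1`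
  (`x_n u_n → u̇_n`, `u_n² → -ẋ_n`);
* transfer (one shell up): `α₀(1,1,0,(0,0,1)) = 1`, `α₀(1,0,1,(0,1,0)) = α₀(0,1,1,(1,0,0)) = -1/2`
  (`u_n² → ẋ_{n+1}`, `u_n x_{n+1} → -u̇_n`);
* seed `σ`: `σ(0,1,1,(0,0,1)) = σ(1,0,1,(0,0,1)) = 1/2`, `σ(1,1,0,(0,1,0)) = σ(1,1,0,(1,0,0)) = -1/2`
  (`x_n u_n → u̇_{n+1}`, `u_n u_{n+1} → -ẋ_n`).

STRUCTURE USED IN THE PROOF. Both tables are of the skew form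
`α = τ - (13)τ + (12)τ - (12)(13)τ`, i.e.
`α(a,b,c,(μ₁,μ₂,μ₃)) = τ(a,b,c,(μ₁,μ₂,μ₃)) - τ(c,b,a,(μ₃,μ₂,μ₁)) + τ(b,a,c,(μ₂,μ₁,μ₃)) - τ(c,a,b,(μ₃,μ₁,μ₂))`,
with the single-row generators `τ_α(0,1,1,(0,0,0)) = 1/2`, `τ_α(0,1,1,(1,0,0)) = -1/2` and
`τ_σ(0,1,1,(0,0,1)) = 1/2`. ANY table of this form is symmetric (4.2) and satisfies the six-term
cancellation (4.3) identically (`(12)` fixes it, and the sum over `S₃` kills `1 - (13)`):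
`heteroclinicTriggerChain_isSymmetricCoeff_of_skew`, `heteroclinicTriggerChain_isCancellingCoeff_of_skew`
(pure `ring`, no case analysis). The rest is finite algebra: the closed forms of
`quadTerm 1 α₀` / `quadTerm 1 σ` per component (`simp [quadTerm, sum_shiftSet, Fin.sum_univ_four]`),
the value set `{0, ±1/2, ±1, ±β/2}` of `α₀ + βσ` on `S` (comparability with spread `2/β`), purity,
`i₁`-parity, the DIAGONAL polarisation of `quadTerm 1 α₀` at the pure state `δ_{(i₀,0)}` with the
single positive entry `d(i₁,0) = 1` (`d(i₁,-1) = -2^{-5/2}`, all other entries `0`), the reduction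
of the exact `ε₀ = 1` cascade on three-slot families to the arc system `ẋ = -u²`, `u̇ = xu - uy`,
`ẏ = u²`, and the seed identity `quadTerm 1 σ H (i₁,1) = x·u`.

HONEST FRAMING: a finite design fact about a MODEL lattice table in Tao's class E₂(R) (the
existential crux K2 of a line on class rung TL-M3). Nothing here is a statement about the
Navier–Stokes equations; no summit and no rung is proved by this file.
-/

noncomputable section

set_option linter.dupNamespace false
-- the registered stub signature spells parity with the deprecated `Xor'` (route file rev 1)
set_option linter.deprecated false

open Literature.Analysis.FluidPDE.TaoCascade

namespace Summit.NavierStokesRegularity.NavierStokesRegularity.Theorems.TriggerChainTable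

/-- A table of the skew form `τ - (13)τ + (12)τ - (12)(13)τ` is symmetric (4.2): the slot
transposition `(12)` permutes its four terms. [this file] -/
theorem heteroclinicTriggerChain_isSymmetricCoeff_of_skew {m : ℕ}
    (τ α : Fin m → Fin m → Fin m → ℤ × ℤ × ℤ → ℝ)
    (hα : α = fun (a b c : Fin m) (μ : ℤ × ℤ × ℤ) => τ a b c μ - τ c b a (μ.2.2, μ.2.1, μ.1) +
      τ b a c (μ.2.1, μ.1, μ.2.2) - τ c a b (μ.2.2, μ.1, μ.2.1)) :
    IsSymmetricCoeff α := by
  intro a b c μ₁ μ₂ μ₃ _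
  rw [hα]
  ring

/-- A table of the skew form `τ - (13)τ + (12)τ - (12)(13)τ` satisfies the six-term cancellation
(4.3): the sum over all slot permutations annihilates `1 - (13)`. [this file] -/
theorem heteroclinicTriggerChain_isCancellingCoeff_of_skew {m : ℕ}
    (τ α : Fin m → Fin m → Fin m → ℤ × ℤ × ℤ → ℝ)
    (hα : α = fun (a b c : Fin m) (μ : ℤ × ℤ × ℤ) => τ a b c μ - τ c b a (μ.2.2, μ.2.1, μ.1) +
      τ b a c (μ.2.1, μ.1, μ.2.2) - τ c a b (μ.2.2, μ.1, μ.2.1)) :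
    IsCancellingCoeff α := by
  intro a b c μ₁ μ₂ μ₃ _
  rw [hα]
  ring

/-- Closed forms of the cascade nonlinearity `quadTerm 1 α₀` of the trigger/transfer table, per
component: `ẋ_n`-term `-Λ_n u_n² + Λ_{n-1} u_{n-1}²`, `u̇_n`-term `Λ_n (x_n u_n - u_n x_{n+1})`,
idle components `0` (`Λ_k = 2^{5k/2}`). [this file] -/
theorem heteroclinicTriggerChain_quadTerm_trigger (τ α₀ : Fin 4 → Fin 4 → Fin 4 → ℤ × ℤ × ℤ → ℝ)
    (hτ : τ = fun (a b c : Fin 4) (μ : ℤ × ℤ × ℤ) => if a = 0 ∧ b = 1 ∧ c = 1 then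
      (if μ = (0, 0, 0) then (1 : ℝ) / 2 else if μ = (1, 0, 0) then -(1 / 2) else 0) else 0)
    (hα₀ : α₀ = fun (a b c : Fin 4) (μ : ℤ × ℤ × ℤ) => τ a b c μ - τ c b a (μ.2.2, μ.2.1, μ.1) +
      τ b a c (μ.2.1, μ.1, μ.2.2) - τ c a b (μ.2.2, μ.1, μ.2.1)) :
    (∀ (X : Fin 4 → ℤ → ℝ → ℝ) (n : ℤ) (t : ℝ), quadTerm 1 α₀ X 0 n t =
      -((1 + 1 : ℝ) ^ ((5 : ℝ) * n / 2) * (X 1 n t * X 1 n t)) +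
        (1 + 1 : ℝ) ^ ((5 : ℝ) * ((n : ℝ) - 1) / 2) * (X 1 (n - 1) t * X 1 (n - 1) t)) ∧
    (∀ (X : Fin 4 → ℤ → ℝ → ℝ) (n : ℤ) (t : ℝ), quadTerm 1 α₀ X 1 n t =
      (1 + 1 : ℝ) ^ ((5 : ℝ) * n / 2) * (X 0 n t * X 1 n t - X 1 n t * X 0 (n + 1) t)) ∧
    (∀ (X : Fin 4 → ℤ → ℝ → ℝ) (n : ℤ) (t : ℝ), quadTerm 1 α₀ X 2 n t = 0) ∧
    (∀ (X : Fin 4 → ℤ → ℝ → ℝ) (n : ℤ) (t : ℝ), quadTerm 1 α₀ X 3 n t = 0) := by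
  subst hα₀ hτ
  refine ⟨fun X n t => ?_, fun X n t => ?_, fun X n t => ?_, fun X n t => ?_⟩ <;>
    simp only [quadTerm, sum_shiftSet, Fin.sum_univ_four] <;> simp <;> ring

/-- Closed forms of the seed nonlinearity `quadTerm 1 σ`, per component: `ẋ_n`-term
`-Λ_n u_n u_{n+1}`, `u̇_n`-term `Λ_{n-1} x_{n-1} u_{n-1}`, idle components `0`. [this file] -/
theorem heteroclinicTriggerChain_quadTerm_seed (τ σ : Fin 4 → Fin 4 → Fin 4 → ℤ × ℤ × ℤ → ℝ)
    (hτ : τ = fun (a b c : Fin 4) (μ : ℤ × ℤ × ℤ) => if a = 0 ∧ b = 1 ∧ c = 1 then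
      (if μ = (0, 0, 1) then (1 : ℝ) / 2 else 0) else 0)
    (hσ : σ = fun (a b c : Fin 4) (μ : ℤ × ℤ × ℤ) => τ a b c μ - τ c b a (μ.2.2, μ.2.1, μ.1) +
      τ b a c (μ.2.1, μ.1, μ.2.2) - τ c a b (μ.2.2, μ.1, μ.2.1)) :
    (∀ (X : Fin 4 → ℤ → ℝ → ℝ) (n : ℤ) (t : ℝ), quadTerm 1 σ X 0 n t =
      -((1 + 1 : ℝ) ^ ((5 : ℝ) * n / 2) * (X 1 n t * X 1 (n + 1) t))) ∧
    (∀ (X : Fin 4 → ℤ → ℝ → ℝ) (n : ℤ) (t : ℝ), quadTerm 1 σ X 1 n t =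
      (1 + 1 : ℝ) ^ ((5 : ℝ) * ((n : ℝ) - 1) / 2) * (X 0 (n - 1) t * X 1 (n - 1) t)) ∧
    (∀ (X : Fin 4 → ℤ → ℝ → ℝ) (n : ℤ) (t : ℝ), quadTerm 1 σ X 2 n t = 0) ∧
    (∀ (X : Fin 4 → ℤ → ℝ → ℝ) (n : ℤ) (t : ℝ), quadTerm 1 σ X 3 n t = 0) := by
  subst hσ hτ
  refine ⟨fun X n t => ?_, fun X n t => ?_, fun X n t => ?_, fun X n t => ?_⟩ <;>
    simp only [quadTerm, sum_shiftSet, Fin.sum_univ_four] <;> simp <;> ring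

/-- On the shift set, `α₀` takes only the values `0, ±1/2, ±1`, `σ` only `0, ±1/2`, and their
supports are disjoint. [this file] -/
theorem heteroclinicTriggerChain_tables_values (τ α₀ τ' σ : Fin 4 → Fin 4 → Fin 4 → ℤ × ℤ × ℤ → ℝ)
    (hτ : τ = fun (a b c : Fin 4) (μ : ℤ × ℤ × ℤ) => if a = 0 ∧ b = 1 ∧ c = 1 then
      (if μ = (0, 0, 0) then (1 : ℝ) / 2 else if μ = (1, 0, 0) then -(1 / 2) else 0) else 0)
    (hα₀ : α₀ = fun (a b c : Fin 4) (μ : ℤ × ℤ × ℤ) => τ a b c μ - τ c b a (μ.2.2, μ.2.1, μ.1) +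
      τ b a c (μ.2.1, μ.1, μ.2.2) - τ c a b (μ.2.2, μ.1, μ.2.1))
    (hτ' : τ' = fun (a b c : Fin 4) (μ : ℤ × ℤ × ℤ) => if a = 0 ∧ b = 1 ∧ c = 1 then
      (if μ = (0, 0, 1) then (1 : ℝ) / 2 else 0) else 0)
    (hσ : σ = fun (a b c : Fin 4) (μ : ℤ × ℤ × ℤ) => τ' a b c μ - τ' c b a (μ.2.2, μ.2.1, μ.1) +
      τ' b a c (μ.2.1, μ.1, μ.2.2) - τ' c a b (μ.2.2, μ.1, μ.2.1)) :
    ∀ (a b c : Fin 4) (μ : ℤ × ℤ × ℤ), μ ∈ shiftSet →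
      (α₀ a b c μ = 0 ∨ α₀ a b c μ = 1 / 2 ∨ α₀ a b c μ = -(1 / 2) ∨ α₀ a b c μ = 1 ∨
        α₀ a b c μ = -1) ∧
      (σ a b c μ = 0 ∨ σ a b c μ = 1 / 2 ∨ σ a b c μ = -(1 / 2)) ∧
      (α₀ a b c μ = 0 ∨ σ a b c μ = 0) := by
  intro a b c μ hμ
  rw [mem_shiftSet_iff] at hμ
  subst hα₀ hσ hτ hτ'
  rcases hμ with rfl | rfl | rfl | rfl <;> fin_cases a <;> fin_cases b <;> fin_cases c <;> norm_num

/-- **Registered stub `stub_static` of crux `TriggerChainTable` (item stmt-NavierStokesRegularity-22786),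
verbatim.** There are `R = 2`, an explicit trigger/transfer table `α₀` and seed table `σ` (module
docstring) with `α₀ ∈ E₂(2)`, `α₀ + βσ ∈ E₂(2/β)` for all `β ∈ (0,1]`, modes `i₀ = 0 ≠ i₁ = 1`, rate
`e = 1` and a diagonal rate table `d` such that: pure-`i₀` families annihilate both nonlinearities;
entries with an odd number of `i₁`-slots vanish; the polarisation of `quadTerm 1 α₀` at the pure state
`δ_{(i₀,0)}` is `Y ↦ d · Y` with `d(i₁,0) = e` and `d ≤ 0` elsewhere; every family supported on the
three slots `(i₀,0), (i₁,0), (i₀,1)` solving `ẋ = -eu²`, `u̇ = exu - euy`, `ẏ = eu²` is an exact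
solution of the `ε₀ = 1` cascade of `α₀`; and `quadTerm 1 σ H (i₁,1) = c₀·x·u` with `c₀ = 1`. [this file] -/
theorem stub_static : ∃ R : ℝ, 1 ≤ R ∧ ∃ α₀ σ : Fin 4 → Fin
    4 → Fin 4 → ℤ × ℤ × ℤ → ℝ, Literature.Analysis.FluidPDE.TaoCascade.InTableClass R α₀ ∧ (∀ β :
    ℝ, 0 < β → β ≤ 1 → Literature.Analysis.FluidPDE.TaoCascade.InTableClass (R / β) (fun j₁ j₂ j₃
    μ => α₀ j₁ j₂ j₃ μ + β * σ j₁ j₂ j₃ μ)) ∧ ∃ (i₀ i₁ : Fin 4) (e : ℝ) (d : Fin 4 → ℤ → ℝ), i₀ ≠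
    i₁ ∧ 0 < e ∧ (∀ X : Fin 4 → ℤ → ℝ → ℝ, (∀ i n t, i ≠ i₀ → X i n t = 0) → ∀ i n t,
    Literature.Analysis.FluidPDE.TaoCascade.quadTerm 1 α₀ X i n t = 0 ∧
    Literature.Analysis.FluidPDE.TaoCascade.quadTerm 1 σ X i n t = 0) ∧ (∀ (j₁ j₂ j₃ : Fin 4) (μ :
    ℤ × ℤ × ℤ), Xor' (Xor' (j₁ = i₁) (j₂ = i₁)) (j₃ = i₁) → α₀ j₁ j₂ j₃ μ = 0 ∧ σ j₁ j₂ j₃ μ = 0)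
    ∧ (∀ (Y : Fin 4 → ℤ → ℝ → ℝ) (i : Fin 4) (n : ℤ) (t : ℝ),
    Literature.Analysis.FluidPDE.TaoCascade.quadTerm 1 α₀ (fun j m s => (fun j m (_ : ℝ) => if j =
    i₀ ∧ m = 0 then (1 : ℝ) else 0) j m s + Y j m s) i n t -
    Literature.Analysis.FluidPDE.TaoCascade.quadTerm 1 α₀ (fun j m (_ : ℝ) => if j = i₀ ∧ m = 0
    then (1 : ℝ) else 0) i n t - Literature.Analysis.FluidPDE.TaoCascade.quadTerm 1 α₀ Y i n t = d
    i n * Y i n t) ∧ d i₁ 0 = e ∧ (∀ i n, ¬ (i = i₁ ∧ n = 0) → d i n ≤ 0) ∧ (∀ H : Fin 4 → ℤ → ℝ →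
    ℝ, (∀ (i : Fin 4) (n : ℤ) (t : ℝ), ¬((i = i₀ ∧ n = 0) ∨ (i = i₁ ∧ n = 0) ∨ (i = i₀ ∧ n = 1)) →
    H i n t = 0) → (∀ t : ℝ, HasDerivAt (H i₀ 0) (-(e * H i₁ 0 t ^ 2)) t) → (∀ t : ℝ, HasDerivAt
    (H i₁ 0) (e * H i₀ 0 t * H i₁ 0 t - e * H i₁ 0 t * H i₀ 1 t) t) → (∀ t : ℝ, HasDerivAt (H i₀
    1) (e * H i₁ 0 t ^ 2) t) → ∀ i n t, HasDerivAt (H i n)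
    (Literature.Analysis.FluidPDE.TaoCascade.quadTerm 1 α₀ H i n t) t) ∧ (∃ c₀ : ℝ, c₀ ≠ 0 ∧ ∀ H :
    Fin 4 → ℤ → ℝ → ℝ, (∀ (i : Fin 4) (n : ℤ) (t : ℝ), ¬((i = i₀ ∧ n = 0) ∨ (i = i₁ ∧ n = 0) ∨ (i
    = i₀ ∧ n = 1)) → H i n t = 0) → ∀ t : ℝ, Literature.Analysis.FluidPDE.TaoCascade.quadTerm 1 σ
    H i₁ 1 t = c₀ * (H i₀ 0 t * H i₁ 0 t)) := by
  classical
  -- the generators and the two skew tables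
  obtain ⟨τ, hτ⟩ : ∃ τ : Fin 4 → Fin 4 → Fin 4 → ℤ × ℤ × ℤ → ℝ, τ =
      fun (a b c : Fin 4) (μ : ℤ × ℤ × ℤ) => if a = 0 ∧ b = 1 ∧ c = 1 then
        (if μ = (0, 0, 0) then (1 : ℝ) / 2 else if μ = (1, 0, 0) then -(1 / 2) else 0) else 0 :=
    ⟨_, rfl⟩
  obtain ⟨α₀, hα₀⟩ : ∃ α₀ : Fin 4 → Fin 4 → Fin 4 → ℤ × ℤ × ℤ → ℝ, α₀ =
      fun (a b c : Fin 4) (μ : ℤ × ℤ × ℤ) => τ a b c μ - τ c b a (μ.2.2, μ.2.1, μ.1) + τ b a c (μ.2.1, μ.1, μ.2.2) -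
        τ c a b (μ.2.2, μ.1, μ.2.1) := ⟨_, rfl⟩
  obtain ⟨τ', hτ'⟩ : ∃ τ' : Fin 4 → Fin 4 → Fin 4 → ℤ × ℤ × ℤ → ℝ, τ' =
      fun (a b c : Fin 4) (μ : ℤ × ℤ × ℤ) => if a = 0 ∧ b = 1 ∧ c = 1 then (if μ = (0, 0, 1) then (1 : ℝ) / 2 else 0) else 0 :=
    ⟨_, rfl⟩
  obtain ⟨σ, hσ⟩ : ∃ σ : Fin 4 → Fin 4 → Fin 4 → ℤ × ℤ × ℤ → ℝ, σ =
      fun (a b c : Fin 4) (μ : ℤ × ℤ × ℤ) => τ' a b c μ - τ' c b a (μ.2.2, μ.2.1, μ.1) + τ' b a c (μ.2.1, μ.1, μ.2.2) -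
        τ' c a b (μ.2.2, μ.1, μ.2.1) := ⟨_, rfl⟩
  obtain ⟨hq0, hq1, hq2, hq3⟩ := heteroclinicTriggerChain_quadTerm_trigger τ α₀ hτ hα₀
  obtain ⟨hs0, hs1, hs2, hs3⟩ := heteroclinicTriggerChain_quadTerm_seed τ' σ hτ' hσ
  have hval := heteroclinicTriggerChain_tables_values τ α₀ τ' σ hτ hα₀ hτ' hσ
  have hsymα := heteroclinicTriggerChain_isSymmetricCoeff_of_skew τ α₀ hα₀
  have hsymσ := heteroclinicTriggerChain_isSymmetricCoeff_of_skew τ' σ hσ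
  have hcanα := heteroclinicTriggerChain_isCancellingCoeff_of_skew τ α₀ hα₀
  have hcanσ := heteroclinicTriggerChain_isCancellingCoeff_of_skew τ' σ hσ
  -- the generators vanish off the row `(0,1,1)`
  have hτ0 : ∀ (a b c : Fin 4) (μ : ℤ × ℤ × ℤ), ¬(a = 0 ∧ b = 1 ∧ c = 1) → τ a b c μ = 0 := by
    intro a b c μ h; rw [hτ]; exact if_neg h
  have hτ'0 : ∀ (a b c : Fin 4) (μ : ℤ × ℤ × ℤ), ¬(a = 0 ∧ b = 1 ∧ c = 1) → τ' a b c μ = 0 := by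
    intro a b c μ h; rw [hτ']; exact if_neg h
  -- comparability of the pencil `α₀ + βσ` with spread `2/β`, `β ∈ (0,1]`
  have hcomp : ∀ β : ℝ, 0 < β → β ≤ 1 →
      IsComparableCoeff (2 / β) (fun j₁ j₂ j₃ μ => α₀ j₁ j₂ j₃ μ + β * σ j₁ j₂ j₃ μ) := by
    intro β hβ hβ1 a b c μ hμ
    dsimp only
    rw [inv_div]
    obtain ⟨hvα, hvσ, hdisj⟩ := hval a b c μ hμ
    rcases hdisj with h0 | h0 <;> rw [h0]
    · rw [zero_add]
      rcases hvσ with h | h | h <;> rw [h]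
      · simp
      · rw [abs_of_pos (by positivity)]
        exact ⟨by linarith, Or.inr (by linarith)⟩
      · rw [mul_neg, abs_neg, abs_of_pos (by positivity)]
        exact ⟨by linarith, Or.inr (by linarith)⟩
    · rw [mul_zero, add_zero]
      rcases hvα with h | h | h | h | h <;> rw [h]
      · simp
      · rw [abs_of_pos (by norm_num)]
        exact ⟨by norm_num, Or.inr (by linarith)⟩
      · rw [abs_neg, abs_of_pos (by norm_num)]
        exact ⟨by norm_num, Or.inr (by linarith)⟩
      · rw [abs_one]
        exact ⟨le_rfl, Or.inr (by linarith)⟩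
      · rw [abs_neg, abs_one]
        exact ⟨le_rfl, Or.inr (by linarith)⟩
  -- the diagonal rate table of the polarisation at the pure state
  obtain ⟨d, hd⟩ : ∃ d : Fin 4 → ℤ → ℝ, d = fun (i : Fin 4) (n : ℤ) => if i = 1 then
      (1 + 1 : ℝ) ^ ((5 : ℝ) * n / 2) *
        ((if n = 0 then (1 : ℝ) else 0) - (if n + 1 = 0 then (1 : ℝ) else 0)) else 0 := ⟨_, rfl⟩
  refine ⟨2, by norm_num, α₀, σ, ⟨hsymα, hcanα, ?_⟩, fun β hβ hβ1 => ⟨?_, ?_, hcomp β hβ hβ1⟩,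
    0, 1, 1, d, by decide, one_pos, ?_, ?_, ?_, ?_, ?_, ?_, 1, one_ne_zero, ?_⟩
  · -- comparability of `α₀` itself with spread `2`
    intro a b c μ hμ
    obtain ⟨hvα, -, -⟩ := hval a b c μ hμ
    rcases hvα with h | h | h | h | h <;> rw [h] <;> norm_num
  · -- symmetry of the pencil
    intro a b c μ₁ μ₂ μ₃ hμ
    dsimp only
    rw [hsymα a b c μ₁ μ₂ μ₃ hμ, hsymσ a b c μ₁ μ₂ μ₃ hμ]
  · -- cancellation of the pencil
    intro a b c μ₁ μ₂ μ₃ hμ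
    dsimp only
    have h1 := hcanα a b c μ₁ μ₂ μ₃ hμ
    have h2 := hcanσ a b c μ₁ μ₂ μ₃ hμ
    linear_combination h1 + β * h2
  · -- purity: pure-`i₀` families are equilibria of both tables
    intro X hX i n t
    have h1 : ∀ m s, X 1 m s = 0 := fun m s => hX 1 m s (by decide)
    fin_cases i <;> simp [hq0, hq1, hq2, hq3, hs0, hs1, hs2, hs3, h1]
  · -- parity in the trigger mode `i₁ = 1`: every generator row has exactly two `1`-slots
    intro a b c μ h
    have h1 : ¬(a = 0 ∧ b = 1 ∧ c = 1) := by
      rintro ⟨rfl, rfl, rfl⟩; simp [Xor'] at h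
    have h2 : ¬(c = 0 ∧ b = 1 ∧ a = 1) := by
      rintro ⟨rfl, rfl, rfl⟩; simp [Xor'] at h
    have h3 : ¬(b = 0 ∧ a = 1 ∧ c = 1) := by
      rintro ⟨rfl, rfl, rfl⟩; simp [Xor'] at h
    have h4 : ¬(c = 0 ∧ a = 1 ∧ b = 1) := by
      rintro ⟨rfl, rfl, rfl⟩; simp [Xor'] at h
    rw [hα₀, hσ]
    dsimp only
    rw [hτ0 _ _ _ _ h1, hτ0 _ _ _ _ h2, hτ0 _ _ _ _ h3, hτ0 _ _ _ _ h4,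
      hτ'0 _ _ _ _ h1, hτ'0 _ _ _ _ h2, hτ'0 _ _ _ _ h3, hτ'0 _ _ _ _ h4]
    norm_num
  · -- the polarisation at the pure state is diagonal with table `d`
    intro Y i n t
    rw [hd]
    fin_cases i
    · simp [hq0]
    · simp [hq1]; ring
    · simp [hq2]
    · simp [hq3]
  · -- `d (i₁, 0) = e = 1`
    rw [hd]; simp
  · -- `d ≤ 0` off the trigger slot
    intro i n hin
    rw [hd]
    dsimp only
    by_cases h1 : i = 1
    · have hn : n ≠ 0 := fun h => hin ⟨h1, h⟩
      rw [if_pos h1, if_neg hn]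
      by_cases h3 : n + 1 = 0
      · rw [if_pos h3]
        have : (0 : ℝ) < (1 + 1 : ℝ) ^ ((5 : ℝ) * n / 2) := Real.rpow_pos_of_pos (by norm_num) _
        nlinarith
      · rw [if_neg h3]; simp
    · rw [if_neg h1]
  · -- exactness: three-slot solutions of the arc system solve the full cascade of `α₀`
    intro H hsupp o1 o2 o3 i n t
    have hz : ∀ (i : Fin 4) (n : ℤ), ¬((i = 0 ∧ n = 0) ∨ (i = 1 ∧ n = 0) ∨ (i = 0 ∧ n = 1)) →
        H i n = fun _ => 0 := fun i n h => funext fun s => hsupp i n s h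
    fin_cases i
    · -- carrier mode `i₀ = 0`
      show HasDerivAt (H 0 n) (quadTerm 1 α₀ H 0 n t) t
      rw [hq0]
      by_cases hn0 : n = 0
      · subst hn0
        have h1 : H 1 (-1) t = 0 := hsupp 1 (-1) t (by omega)
        convert o1 t using 1
        simp [h1]; ring
      by_cases hn1 : n = 1
      · subst hn1
        have h1 : H 1 1 t = 0 := hsupp 1 1 t (by omega)
        convert o3 t using 1
        simp [h1]; ring
      · have h1 : H 1 n t = 0 := hsupp 1 n t (by omega)
        have h2 : H 1 (n - 1) t = 0 := hsupp 1 (n - 1) t (by omega)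
        simp only [h1, h2, mul_zero, neg_zero, zero_add]
        rw [hz 0 n (by omega)]
        exact hasDerivAt_const t 0
    · -- trigger mode `i₁ = 1`
      show HasDerivAt (H 1 n) (quadTerm 1 α₀ H 1 n t) t
      rw [hq1]
      by_cases hn0 : n = 0
      · subst hn0
        convert o2 t using 1
        simp
      · have h1 : H 1 n t = 0 := hsupp 1 n t (by omega)
        simp only [h1, mul_zero, zero_mul, sub_self]
        rw [hz 1 n (by omega)]
        exact hasDerivAt_const t 0
    · -- idle mode `2`
      show HasDerivAt (H 2 n) (quadTerm 1 α₀ H 2 n t) t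
      rw [hq2, hz 2 n (by omega)]
      exact hasDerivAt_const t 0
    · -- idle mode `3`
      show HasDerivAt (H 3 n) (quadTerm 1 α₀ H 3 n t) t
      rw [hq3, hz 3 n (by omega)]
      exact hasDerivAt_const t 0
  · -- the seed identity at the upper trigger `(i₁, 1)`
    intro H _ t
    rw [hs1]
    simp

end Summit.NavierStokesRegularity.NavierStokesRegularity.Theorems.TriggerChainTable
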